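import Summits.QuantumFields.QCD.Theses.SmallBetaInfraredSplit
import Summits.QuantumFields.QCD.Theorems.SmallBetaInfraredSplitTwoPointKernelStructure
import Summits.Ventures.YMGap.Conjectures.StrongCouplingChiralLROProof
import Literature.MathematicalPhysics.StatisticalMechanics.InfraredBoundSpectralStep

/-!
# Route `SmallBetaInfraredSplit` (sub QCD) — crux `IRBoundSmallBeta` (stmt-QuantumFields-27240), PROVED
# (landing of the literature-prover's attached argument; `β₀ = 1`, `C = 0`)

The β-stable infrared bound for the gauge-level `m = 0` two-point kernel `G_β` of `ψ̄ψ` holds with NO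
`O(β)` loss: `Σ_x Σ_y h(x)(−Δh)(y) G_β(x,y) ≤ (2N)²·(1/N)·‖h‖² = 4N‖h‖²` for every `β ≥ 0` (so any `β₀`;
we take `β₀ = 1`, `C = 0`), every even torus and every real `h`.

Proof (credit: cell `pub-ymgap`, literature-prover seat qcd-lit g22, who attached this argument as item
evidence 2026-08-28T23:48Z/23:50Z and may not write under `Theorems/`; re-derived here because the evidence
store is not mounted in a prover jail):
* the route's explicit determinant/propagator kernel IS the venture's `ssTwoPoint N ν L β 0` (definitionally);
* `Summit.Ventures.YMGap.Conjectures.MesonWeight.infraredBound` (tree): the MODE-WISE bound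
  `2(ν − C(χ))·Re Ĝ_β(χ) ≤ 4N` for every character `χ`, at EVERY `β ≥ 0`, uniformly in `L`
  (Fröhlich–Israel–Lieb–Simon Gaussian domination for the `β`-dressed meson weight, reflection positive via the
  all-colour hermitian-square certificate);
* `ComplexSpin.symbolRe_neg_one` (`E_{−1}(χ) = 2(ν − C(χ))`) and the spectral step from mode-wise bounds
  `ComplexSpin.form_le_of_symbol_le` (Parseval), with symmetry and translation invariance of `G_β` from
  `twoPointKernelStructure_proof`.

HONEST FRAMING: the leaf `SalmhoferSeilerSmallBeta` (LADDER-YM rung Q1, RECORD label) is ALREADY a tree theorem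
(`Summit.Ventures.YMGap.Conjectures.salmhoferSeilerSmallBeta_holds`, pub-ymgap); this file only closes the route's
crux by name.  `NeighbourFloorSmallBeta` (27241) stays open; the route is DRAFT by design; nothing about `QCD`
(the summit conjunct), `YangMills`, a mass gap or a continuum limit is proved here.
[cite: SalmhoferSeiler1991, Thm. 3.21 (3.74), (3.110)–(3.113), Remark 4.5; FrohlichIsraelLiebSimon1978]
-/

set_option autoImplicit false

namespace Summit.QuantumFields.QCD.Theorems.SmallBetaInfraredSplit

open Finset
open Literature.MathematicalPhysics.QuantumFieldTheory
open Literature.MathematicalPhysics.QuantumLattice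
open Literature.MathematicalPhysics.StatisticalMechanics
open Literature.MathematicalPhysics.StatisticalMechanics.ComplexSpin
open Literature.Probability.LatticeModels (TorusSite)
open Summit.Ventures.YMGap.Conjectures

/-- The route's crux `IRBoundSmallBeta` (stmt-QuantumFields-27240) BY NAME, with `β₀ = 1`, `C = 0`:
`Σ_x Σ_y h(x)(−Δh)(y) G_β(x,y) ≤ (2N)²(1/N + 0·β)‖h‖²` for `0 ≤ β < 1`, even `L ≥ 4`, all real `h`.
[cite: SalmhoferSeiler1991, Thm. 3.21 (3.74) and Remark 4.5] -/
theorem irBoundSmallBeta_proof :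
    Summit.QuantumFields.QCD.Theses.SmallBetaInfraredSplit.IRBoundSmallBeta := by
  intro N ν hN1 hN4 hν
  refine ⟨1, one_pos, 0, le_rfl, fun β hβ _ L _ hL hL4 h => ?_⟩
  haveI : NeZero ν := ⟨by omega⟩
  -- the route's kernel is the venture's `ssTwoPoint N ν L β 0`
  set K : TorusSite ν L → TorusSite ν L → ℝ := fun x y => ssTwoPoint N ν L β 0 x y with hK
  have hKdef : ∀ x y : TorusSite ν L, K x y =
      (∫ U, (Matrix.det (staggeredDirac (unitaryFundamentalRep (Fin N) ℂ) U 0)).re *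
        (let G := (staggeredDirac (unitaryFundamentalRep (Fin N) ℂ) U 0)⁻¹
         ((∑ a : Fin N, G (x, a) (x, a)) * (∑ b : Fin N, G (y, b) (y, b)) -
            ∑ a : Fin N, ∑ b : Fin N, G (x, a) (y, b) * G (y, b) (x, a)).re)
        ∂(wilsonWeight (d := ν) (L := L) (unitaryFundamentalRep (Fin N) ℂ) β)) /
      ∫ U, (Matrix.det (staggeredDirac (unitaryFundamentalRep (Fin N) ℂ) U 0)).re
        ∂(wilsonWeight (d := ν) (L := L) (unitaryFundamentalRep (Fin N) ℂ) β) := fun x y => rfl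
  -- symmetry and translation invariance of the kernel at every `β`
  have hTPK := twoPointKernelStructure_proof N ν hN1 (by omega) L hL.two_dvd β
  dsimp only at hTPK
  obtain ⟨hS, hT, -⟩ := hTPK
  have hS' : ∀ x y, K x y = K y x := fun x y => by rw [hKdef, hKdef]; exact hS x y
  have hT' : ∀ x y a, K (x + a) (y + a) = K x y := fun x y a => by rw [hKdef, hKdef]; exact hT a x y
  -- the mode-wise infrared bound at every `β ≥ 0`
  have hmode : ∀ χ : AddChar (TorusSite ν L) ℂ, symbolRe (-1) χ * (kernelSymbol K χ).re ≤ 4 * N := by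
    intro χ
    rw [symbolRe_neg_one]
    exact (MesonWeight.infraredBound (N := N) (ν := ν) (L := L) (by omega) hL hβ χ).1
  -- Parseval
  have hmain := form_le_of_symbol_le (s := -1) hT' hS' hmode h
  simp only [stencil_neg_one] at hmain
  have e : ∑ x, ∑ y, h x * (-laplacian h y) * K x y = ∑ x, ∑ y, h x * K x y * (-laplacian h y) :=
    Finset.sum_congr rfl fun x _ => Finset.sum_congr rfl fun y _ => by ring
  have hκ : (2 * N : ℝ) ^ 2 * (1 / N + 0 * β) = 4 * N := by
    have hN : (N : ℝ) ≠ 0 := by exact_mod_cast (show N ≠ 0 by omega)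
    field_simp
    ring
  show ∑ x, ∑ y, h x * (-laplacian h y) * K x y ≤ (2 * N : ℝ) ^ 2 * (1 / N + 0 * β) * normSq h
  rw [e, hκ, ComplexSpin.normSq]
  exact hmain

end Summit.QuantumFields.QCD.Theorems.SmallBetaInfraredSplit
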